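import Summits.ResolutionOfSingularities.ResolutionOfSingularities.Theorems.FrobeniusLadderFInjectiveMacaulayficationAffineBlowupStalkClause
import Summits.ResolutionOfSingularities.ResolutionOfSingularities.Theorems.FrobeniusLadderFInjectiveMacaulayficationStrictTransformChartN
import Summits.ResolutionOfSingularities.ResolutionOfSingularities.Theorems.FrobeniusLadderFInjectiveMacaulayficationPrimeTransfer
import Summits.ResolutionOfSingularities.ResolutionOfSingularities.Theorems.FrobeniusLadderFInjectiveMacaulayficationFiClauseOfRegular
import Summits.ResolutionOfSingularities.ResolutionOfSingularities.Theorems.FrobeniusLadderFInjectiveMacaulayficationDegreeZeroDescent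
import Mathlib.Algebra.CharP.Algebra
import HarnessLib

/-!
# The point blow-up of a hypersurface as an F-injective Macaulayfication: the engine theorem
# (crux `FInjectiveMacaulayfication`, line `Sketch`)

Support file for crux stmt-ResolutionOfSingularities-15315 (`FrobeniusLadder.FInjectiveMacaulayfication`,
line `Sketch`, lead seat c7): stub `stub_hypersurfacePointBlowupFiModel` — the line's calibration recipe
(E8⁰ in characteristic `5`, the characteristic-`2` threefold `ThreefoldFiModel.threefoldFiModel`) packaged
ONCE as an engine theorem, for a general number of variables `n` and a general prime `p`.

Let `k` be a field of characteristic `p`, `S = k[X₀, …, X_{n-1}]`, `f ∈ S`, `R = S/(f)`, `x̄ⱼ` the classes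
of the variables, `𝔪 = (x̄₀, …, x̄_{n-1})`, and let `θᵢ : Xᵢ ↦ Xᵢ, Xⱼ ↦ XⱼXᵢ (j ≠ i)` be the chart
substitutions of the point blow-up. Suppose

* (i) `(f)` is prime;
* (ii) `θᵢ f = Xᵢ^μ gᵢ` with `Xᵢ ∤ f`, `Xᵢ ∤ gᵢ` for every `i` (the strict transforms `gᵢ`);
* (iii) `R_P` is a regular local ring at every prime `P ⊉ 𝔪`;
* (iv) every chart hypersurface `S/(gᵢ)` satisfies the Cohen–Macaulay + Frobenius-closed clause at its
  maximal ideals containing `X̄ᵢ`.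

Then (`hypersurfacePointBlowupFiModel`) there is a proper birational `X' → Spec R` all of whose stalks are
domains in which every system of parameters is weakly regular and generates a Frobenius closed ideal
(the per-stalk clause of the crux, inline form).

Proof. For `0 < n` the model is the blow-up of the origin `X' = affineBlowup 𝔪` (`𝔪 ≠ 0` as `Xᵢ ∉ (f)`),
fed through the stalk form E6″ `AffineBlowupStalkClause.stub_affineBlowupStalkClause` of the blow-up glue:
off `𝔪` the local rings are regular by (iii), hence satisfy the clause (`FiClauseOfRegular`); the chart of
`x̄ᵢ` is `S/(gᵢ)` (`StrictTransformChartN.chart_clause_of_presentationN`), `(gᵢ)` being prime by transfer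
along `θᵢ` (`PrimeTransfer.stub_primeTransfer`, side conditions (ii)) and `Xᵢ ∉ (gᵢ)`
(`PrimeTransfer.X_not_mem_span_of_isPrime`), so (iv) is exactly the on-divisor hypothesis of E6″.
For `n = 0` (no variables) `S = k`, primality forces `f = 0`, `R ≅ k` is a regular ring and
`X' = Spec R` itself (identity map) will do (`Scheme.isRegular_Spec`, `FiClauseOfRegular`).

References: R. Fedder, *F-purity and rational singularity*, Trans. AMS 278 (1983) [Fedder1983];
The Stacks Project, Tag 0804 (charts of a blowing up), Tag 02OS; J. Kollár, *Lectures on Resolution of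
Singularities*, §2.5 (strict transforms of hypersurfaces under point blow-ups). [folklore]
-/

-- single-problem summit: the doubled namespace component is forced
set_option linter.dupNamespace false

noncomputable section

namespace Summit.ResolutionOfSingularities.ResolutionOfSingularities.Theorems.FInjectiveMacaulayfication.HypersurfacePointBlowup

open AlgebraicGeometry CategoryTheory Literature.AlgebraicGeometry.Resolution MvPolynomial
open Summit.ResolutionOfSingularities.ResolutionOfSingularities.Theorems.FInjectiveMacaulayfication

/-! ## The degenerate case `n = 0` -/

/-- With no variables, `S = k[∅] = k` is a field: if `(f)` is prime then `f = 0` and `S/(f) ≅ k` is a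
regular ring. [folklore] -/
theorem isRegularRing_of_isEmpty (k : Type) [Field k] (f : MvPolynomial (Fin 0) k)
    (hfprime : (Ideal.span {f}).IsPrime) : IsRegularRing (MvPolynomial (Fin 0) k ⧸ Ideal.span {f}) := by
  have hf0 : f = 0 := by
    by_contra hne
    have hc : coeff 0 f ≠ 0 := fun h => hne (by rw [MvPolynomial.eq_C_of_isEmpty f, h, C_0])
    exact hfprime.ne_top (Ideal.eq_top_of_isUnit_mem _ (Ideal.mem_span_singleton_self f)
      (by rw [MvPolynomial.eq_C_of_isEmpty f]; exact (IsUnit.mk0 _ hc).map C))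
  have hbot : (⊥ : Ideal (MvPolynomial (Fin 0) k)) = Ideal.span {f} := by
    rw [hf0, Ideal.span_singleton_zero]
  exact IsRegularRing.of_ringEquiv ((MvPolynomial.isEmptyRingEquiv k (Fin 0)).symm.trans
    ((RingEquiv.quotientBot _).symm.trans (Ideal.quotEquivOfEq hbot)))

/-- The spectrum of a regular domain `R` of characteristic `p` is its own model: every stalk of `Spec R`
is a regular local ring of characteristic `p`, hence a domain satisfying the clause (`FiClauseOfRegular`).
[folklore] -/
theorem spec_stalk_clause (p : ℕ) [Fact p.Prime] (R : Type) [CommRing R] [IsDomain R] [CharP R p]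
    [IsRegularRing R] (y : ↥(Spec (.of R))) :
    IsDomain ((Spec (.of R)).presheaf.stalk y) ∧
      ∀ d : ℕ, ringKrullDim ((Spec (.of R)).presheaf.stalk y) = d →
        ∀ s : Fin d → (Spec (.of R)).presheaf.stalk y, (Ideal.span (Set.range s)).radical.IsMaximal →
          RingTheory.Sequence.IsWeaklyRegular ((Spec (.of R)).presheaf.stalk y) (List.ofFn s) ∧
          ∀ z : (Spec (.of R)).presheaf.stalk y, (∃ e : ℕ, z ^ p ^ e ∈
              Ideal.span ((fun w : (Spec (.of R)).presheaf.stalk y => w ^ p ^ e) ''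
                (Ideal.span (Set.range s) : Set ((Spec (.of R)).presheaf.stalk y)))) →
            z ∈ Ideal.span (Set.range s) := by
  haveI : IsRegularLocalRing ((Spec (.of R)).presheaf.stalk y) := Scheme.isRegular_Spec (.of R) y
  haveI : CharP ((Spec (.of R)).presheaf.stalk y) p :=
    CharP.of_ringHom_of_ne_zero
      (((Spec (.of R)).presheaf.germ ⊤ y trivial).hom.comp (Scheme.ΓSpecIso (.of R)).inv.hom) p
      (Fact.out : p.Prime).ne_zero
  have key := FiClauseOfRegular.stub_fiClauseOfRegular p ((Spec (.of R)).presheaf.stalk y)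
  exact key

/-! ## The engine theorem -/

-- budget: the chart presentations are compared against the chart-ring types of `affineBlowup` (≈ 3× default)
set_option maxHeartbeats 800000 in
/-- **THE POINT BLOW-UP OF A HYPERSURFACE AS AN F-INJECTIVE MACAULAYFICATION** (see the module docstring):
for `R = k[X₀, …, X_{n-1}]/(f)` over a field of characteristic `p` with `(f)` prime, chart identities
`θᵢ f = Xᵢ^μ gᵢ` (`Xᵢ ∤ f`, `Xᵢ ∤ gᵢ`), `R` regular off the origin and every chart hypersurface `k[X]/(gᵢ)`
satisfying the clause at its maximal ideals containing `X̄ᵢ`, there is a proper birational `X' → Spec R`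
(the blow-up of the origin) all of whose stalks are domains satisfying the per-stalk clause of the crux.
[folklore] -/
theorem hypersurfacePointBlowupFiModel (p : ℕ) [Fact p.Prime] (k : Type) [Field k] [CharP k p] (n : ℕ)
    (f : MvPolynomial (Fin n) k) (g : Fin n → MvPolynomial (Fin n) k) (μ : ℕ)
    (hfprime : (Ideal.span {f}).IsPrime)
    (hθ : ∀ i : Fin n, MvPolynomial.aeval (fun j : Fin n => if j = i then (MvPolynomial.X i : MvPolynomial (Fin n) k)
        else MvPolynomial.X j * MvPolynomial.X i) f = MvPolynomial.X i ^ μ * g i)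
    (hf : ∀ i : Fin n, f ∉ Ideal.span {(MvPolynomial.X i : MvPolynomial (Fin n) k)})
    (hg : ∀ i : Fin n, g i ∉ Ideal.span {(MvPolynomial.X i : MvPolynomial (Fin n) k)})
    (hoff : ∀ (P : Ideal (MvPolynomial (Fin n) k ⧸ Ideal.span {f})) [P.IsPrime],
      ¬ Ideal.span (Set.range fun j : Fin n => Ideal.Quotient.mk (Ideal.span {f}) (MvPolynomial.X j)) ≤ P →
      IsRegularLocalRing (Localization.AtPrime P))
    (hpts : ∀ (i : Fin n) (Q : Ideal (MvPolynomial (Fin n) k ⧸ Ideal.span {g i})) [Q.IsMaximal],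
      Ideal.Quotient.mk (Ideal.span {g i}) (MvPolynomial.X i) ∈ Q →
      ∀ d : ℕ, ringKrullDim (Localization.AtPrime Q) = d → ∀ s : Fin d → Localization.AtPrime Q,
        (Ideal.span (Set.range s)).radical.IsMaximal →
          RingTheory.Sequence.IsWeaklyRegular (Localization.AtPrime Q) (List.ofFn s) ∧
          ∀ y : Localization.AtPrime Q, (∃ e : ℕ, y ^ p ^ e ∈ Ideal.span
            ((fun z : Localization.AtPrime Q => z ^ p ^ e) ''
              (Ideal.span (Set.range s) : Set (Localization.AtPrime Q)))) → y ∈ Ideal.span (Set.range s)) :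
    ∃ (X' : Scheme.{0}) (π : X' ⟶ Spec (.of (MvPolynomial (Fin n) k ⧸ Ideal.span {f}))), IsProper π ∧
      Literature.AlgebraicGeometry.Resolution.IsBirational π ∧
      ∀ y : X', IsDomain (X'.presheaf.stalk y) ∧ ∀ d : ℕ, ringKrullDim (X'.presheaf.stalk y) = d →
        ∀ s : Fin d → X'.presheaf.stalk y, (Ideal.span (Set.range s)).radical.IsMaximal →
          RingTheory.Sequence.IsWeaklyRegular (X'.presheaf.stalk y) (List.ofFn s) ∧
          ∀ z : X'.presheaf.stalk y, (∃ e : ℕ, z ^ p ^ e ∈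
              Ideal.span ((fun w : X'.presheaf.stalk y => w ^ p ^ e) ''
                (Ideal.span (Set.range s) : Set (X'.presheaf.stalk y)))) →
            z ∈ Ideal.span (Set.range s) := by
  haveI := hfprime
  -- `R = k[X]/(f)` is a Noetherian domain of characteristic `p`
  haveI : IsDomain (MvPolynomial (Fin n) k ⧸ Ideal.span {f}) := Ideal.Quotient.isDomain _
  haveI : CharP (MvPolynomial (Fin n) k ⧸ Ideal.span {f}) p :=
    charP_of_injective_algebraMap (algebraMap k (MvPolynomial (Fin n) k ⧸ Ideal.span {f})).injective p
  rcases Nat.eq_zero_or_pos n with rfl | hn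
  · -- no variables: `R ≅ k` is regular and `Spec R` is its own model
    haveI := isRegularRing_of_isEmpty k f hfprime
    exact ⟨Spec (.of (MvPolynomial (Fin 0) k ⧸ Ideal.span {f})), 𝟙 _, inferInstance,
      ⟨⊤, by simp [dense_univ], by simp [dense_univ], inferInstance⟩,
      spec_stalk_clause p (MvPolynomial (Fin 0) k ⧸ Ideal.span {f})⟩
  -- `0 < n`: the forms
  have hf0 : f ≠ 0 := by
    rintro rfl
    exact hf ⟨0, hn⟩ (Ideal.zero_mem _)
  have hgprime : ∀ i : Fin n, (Ideal.span {g i}).IsPrime := fun i =>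
    (PrimeTransfer.stub_primeTransfer k n i f (g i) μ (hθ i) (hf i) (hg i)).mp hfprime
  have hXg : ∀ i : Fin n, (X i : MvPolynomial (Fin n) k) ∉ Ideal.span {g i} := fun i =>
    PrimeTransfer.X_not_mem_span_of_isPrime (hgprime i) (hg i)
  have hXf : ∀ i : Fin n, (X i : MvPolynomial (Fin n) k) ∉ Ideal.span {f} := fun i =>
    PrimeTransfer.X_not_mem_span_of_isPrime hfprime (hf i)
  -- the centre `𝔪 = (x̄₀, …, x̄_{n-1}) ≠ 0`
  obtain ⟨x, hx⟩ : ∃ x : Fin n → MvPolynomial (Fin n) k ⧸ Ideal.span {f},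
      x = fun j : Fin n => Ideal.Quotient.mk (Ideal.span {f}) (X j) := ⟨_, rfl⟩
  have hxne : ∀ i : Fin n, x i ≠ 0 := fun i h => by
    rw [hx] at h
    exact hXf i (Ideal.Quotient.eq_zero_iff_mem.mp h)
  have hI : Ideal.span (Set.range x) ≠ ⊥ := fun hbot =>
    hxne ⟨0, hn⟩ ((Ideal.mem_bot).mp (hbot ▸ Ideal.subset_span (Set.mem_range_self _)))
  refine ⟨affineBlowup (Ideal.span (Set.range x)), affineBlowup.π (Ideal.span (Set.range x)), inferInstance,
    affineBlowup.isBirational hI, ?_⟩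
  refine AffineBlowupStalkClause.stub_affineBlowupStalkClause p (MvPolynomial (Fin n) k ⧸ Ideal.span {f})
    (Ideal.span (Set.range x)) n x (fun i => Ideal.subset_span (Set.mem_range_self i)) rfl hI ?_ ?_
  · -- off the origin `R_P` is regular, hence satisfies the clause
    intro P _ hP
    have hP' : ¬ Ideal.span (Set.range fun j : Fin n =>
        Ideal.Quotient.mk (Ideal.span {f}) (X j)) ≤ P := by rwa [← hx]
    haveI : IsRegularLocalRing (Localization.AtPrime P) := hoff P hP'
    haveI : CharP (Localization.AtPrime P) p := DegreeZeroDescent.charP_localization_atPrime p P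
    have key := FiClauseOfRegular.stub_fiClauseOfRegular p (Localization.AtPrime P)
    exact key
  · -- on the exceptional divisor, chart by chart, through the strict-transform presentation
    intro i _ Q hQ huQ
    have key := StrictTransformChartN.chart_clause_of_presentationN p k n f hfprime hf0 x hx i (g i) μ
      (hgprime i) (hXg i) (hθ i) (fun Q' _ hQ' => hpts i Q' hQ') Q huQ
    exact key

/-- **Registered form** (lead stub `stub_hypersurfacePointBlowupFiModel` of crux
stmt-ResolutionOfSingularities-15315, line `Sketch`) — `= hypersurfacePointBlowupFiModel`. [folklore] -/
theorem stub_hypersurfacePointBlowupFiModel : ∀ (p : ℕ) [Fact p.Prime] (k : Type) [Field k] [CharP k p] (n : ℕ)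
    (f : MvPolynomial (Fin n) k) (g : Fin n → MvPolynomial (Fin n) k) (μ : ℕ),
    (Ideal.span {f}).IsPrime →
    (∀ i : Fin n, MvPolynomial.aeval (fun j : Fin n => if j = i then (MvPolynomial.X i : MvPolynomial (Fin n) k)
        else MvPolynomial.X j * MvPolynomial.X i) f = MvPolynomial.X i ^ μ * g i) →
    (∀ i : Fin n, f ∉ Ideal.span {(MvPolynomial.X i : MvPolynomial (Fin n) k)}) →
    (∀ i : Fin n, g i ∉ Ideal.span {(MvPolynomial.X i : MvPolynomial (Fin n) k)}) →
    (∀ (P : Ideal (MvPolynomial (Fin n) k ⧸ Ideal.span {f})) [P.IsPrime],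
      ¬ Ideal.span (Set.range fun j : Fin n => Ideal.Quotient.mk (Ideal.span {f}) (MvPolynomial.X j)) ≤ P →
      IsRegularLocalRing (Localization.AtPrime P)) →
    (∀ (i : Fin n) (Q : Ideal (MvPolynomial (Fin n) k ⧸ Ideal.span {g i})) [Q.IsMaximal],
      Ideal.Quotient.mk (Ideal.span {g i}) (MvPolynomial.X i) ∈ Q →
      ∀ d : ℕ, ringKrullDim (Localization.AtPrime Q) = d → ∀ s : Fin d → Localization.AtPrime Q,
        (Ideal.span (Set.range s)).radical.IsMaximal →
          RingTheory.Sequence.IsWeaklyRegular (Localization.AtPrime Q) (List.ofFn s) ∧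
          ∀ y : Localization.AtPrime Q, (∃ e : ℕ, y ^ p ^ e ∈ Ideal.span
            ((fun z : Localization.AtPrime Q => z ^ p ^ e) ''
              (Ideal.span (Set.range s) : Set (Localization.AtPrime Q)))) → y ∈ Ideal.span (Set.range s)) →
    ∃ (X' : Scheme.{0}) (π : X' ⟶ Spec (.of (MvPolynomial (Fin n) k ⧸ Ideal.span {f}))), IsProper π ∧
      Literature.AlgebraicGeometry.Resolution.IsBirational π ∧
      ∀ y : X', IsDomain (X'.presheaf.stalk y) ∧ ∀ d : ℕ, ringKrullDim (X'.presheaf.stalk y) = d →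
        ∀ s : Fin d → X'.presheaf.stalk y, (Ideal.span (Set.range s)).radical.IsMaximal →
          RingTheory.Sequence.IsWeaklyRegular (X'.presheaf.stalk y) (List.ofFn s) ∧
          ∀ z : X'.presheaf.stalk y, (∃ e : ℕ, z ^ p ^ e ∈
              Ideal.span ((fun w : X'.presheaf.stalk y => w ^ p ^ e) ''
                (Ideal.span (Set.range s) : Set (X'.presheaf.stalk y)))) →
            z ∈ Ideal.span (Set.range s) := by
  intro p _ k _ _ n f g μ hfprime hθ hf hg hoff hpts
  exact hypersurfacePointBlowupFiModel p k n f g μ hfprime hθ hf hg (fun P _ hP => hoff P hP)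
    (fun i Q _ hQ => hpts i Q hQ)

end Summit.ResolutionOfSingularities.ResolutionOfSingularities.Theorems.FInjectiveMacaulayfication.HypersurfacePointBlowup

end
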